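import Summits.RiemannHypothesis.RiemannHypothesis.Theorems.GroundBartaPolarPerronFrobeniusLeakageNegPrelim
import HarnessLib

/-!
# A lower bound for the leakage against a NEGATIVE part (route `RiemannHypothesis/GroundBarta`,
crux `PolarPerronFrobenius` stmt-RiemannHypothesis-18390; helper towards an edge-tolerant Barta
floor; part 2 of 2)

Companion of the leakage sign lemma `stub_leakageSign` (file `…GroundBartaFloorLeakageSign`).
There, for a NON-NEGATIVE integrable `v` on the window `[-a, a]` and the leakage kernel
`κ = Φ(1 - χ)` of Riemann's kernel `Φ = weilThetaPhi` (`χ = 1` on `[-a, a]`, `0 ≤ χ ≤ 1`), the Weil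
functional of `f = v ⋆ κ̃` was bounded ABOVE by its polar part, `Re W(v ⋆ κ̃) ≤ 2(∫ v cosh(t/2)) ϖ_a`.
Here we bound it BELOW, for a non-negative `w` (to be the negative part `(Re u)⁻` of a ground
state), by explicit, super-exponentially small multiples of `∫ w` and `√∫ w²`:

  `Re W(w ⋆ κ̃) ≥ -(Π_a ∫ w + Φ(a)(4 √(∫ w²) + 8 ∫ w))`,
  `Π_a := 2 Σ' Λ(n) n^{-1/2} Φ(max a (log n - a))`                (`leakNeg_re_weilFunctional_ge`).

The three terms of `W = polar − prime + arch` for `f = w ⋆ κ̃ ≥ 0`, `f(0) = 0`: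
* POLAR `= ŵ(0) conj κ̂(1) + ŵ(1) conj κ̂(0) ≥ 0` (all four factors are integrals of non-negative
  functions);
* PRIME `= Σ Λ(n) n^{-1/2}(f(log n) + f(−log n))` with `f(x) ≤ Φ(max a (|x| − a)) ∫ w`
  (`leakNeg_leakFun_le_l1`);
* ARCHIMEDEAN, in Bombieri's form `−∫₀^∞ e^{t/2}(f(t) + f(−t))/(2 sinh t) dt` (`f(0) = 0`), with
  `f(±t) ≤ Φ(a) √t √(∫ w²)` (`leakNeg_leakFun_le_l2`, only the collar of width `t` at an edge sees
  the kernel) and `f(±t) ≤ Φ(a) ∫ w`; the integrand is `≤ 2Φ(a)√(∫w²) t^{-1/2}` on `(0, 1]` and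
  `≤ 4Φ(a)(∫ w) e^{-t/2}` on `(1, ∞)`, which integrate to `4Φ(a)√(∫w²)` and `8Φ(a)∫w`.
Elementary; the explicit formula in Bombieri's form (Bombieri 2000, Thm 2) is the only input.
[folklore]
-/

set_option linter.dupNamespace false

noncomputable section

open Set MeasureTheory Filter Complex
open scoped Real Topology ComplexConjugate ArithmeticFunction.vonMangoldt

namespace Summit.RiemannHypothesis.RiemannHypothesis.Theorems.GroundBartaFloor

open Literature.NumberTheory.LFunctions
open Summit.RiemannHypothesis.RiemannHypothesis.Theorems.GroundStatesConvergeToXi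

/-! ## The lower leakage bound -/

/-- **Lower bound for the leakage against a non-negative `w`.**  For `a > 0`, a non-negative
`w ∈ L¹ ∩ L²` vanishing off `[-a, a]`, a cut-off `χ` with `χ = 1` on `[-a, a]`, `0 ≤ χ ≤ 1`, and the
leakage kernel `κ = Φ(1 - χ)` in the exponential class:
`Re W(w ⋆ κ̃) ≥ -(Π_a ∫ w + Φ(a)(4√(∫ w²) + 8 ∫ w))` with `Π_a = 2 Σ' Λ(n) n^{-1/2} Φ(max a (log n - a))`
— the polar term is `≥ 0`, the prime term is `≤ Π_a ∫ w`, and Bombieri's archimedean term is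
`≥ -Φ(a)(4√(∫w²) + 8∫w)`. [folklore] -/
theorem leakNeg_re_weilFunctional_ge :
    ∀ (a : ℝ) (w : ℝ → ℝ) (χ : ℝ → ℝ), 0 < a → Integrable w → MemLp w 2 → (∀ t, 0 ≤ w t) →
      (∀ t, t ∉ Icc (-a) a → w t = 0) →
      (∀ t ∈ Icc (-a) a, χ t = 1) → (∀ t, 0 ≤ χ t ∧ χ t ≤ 1) →
      ContDiff ℝ (⊤ : ℕ∞) (fun t : ℝ => ((weilThetaPhi t * (1 - χ t) : ℝ) : ℂ)) →
      (∀ k : ℕ, ∃ C : ℝ, ∀ t : ℝ,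
        ‖iteratedDeriv k (fun t : ℝ => ((weilThetaPhi t * (1 - χ t) : ℝ) : ℂ)) t‖ ≤
          C * Real.exp (-(1 * |t|))) →
      -((2 * ∑' n : ℕ, (Λ n : ℝ) / Real.sqrt n * weilThetaPhi (max a (Real.log n - a))) *
            (∫ t, w t) +
          weilThetaPhi a * (4 * Real.sqrt (∫ t, w t ^ 2) + 8 * ∫ t, w t)) ≤
        (weilFunctional (weilConv (fun t => ((w t : ℝ) : ℂ))
          (weilReflect fun t => ((weilThetaPhi t * (1 - χ t) : ℝ) : ℂ)))).re := by
  intro a w χ ha hwi hw2 hw0 hws hχ1 hχ01 hκd hκb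
  -- notation
  set wc : ℝ → ℂ := fun t => ((w t : ℝ) : ℂ) with hwc
  set κ : ℝ → ℂ := fun t : ℝ => ((weilThetaPhi t * (1 - χ t) : ℝ) : ℂ) with hκ
  set f : ℝ → ℂ := weilConv wc (weilReflect κ) with hf
  set κr : ℝ → ℝ := fun t => weilThetaPhi t * (1 - χ t) with hκrdef
  set F : ℝ → ℝ := fun t => ∫ u, w u * (weilThetaPhi (-(t - u)) * (1 - χ (-(t - u)))) with hFdef
  set PiA : ℝ := 2 * ∑' n : ℕ, (Λ n : ℝ) / Real.sqrt n * weilThetaPhi (max a (Real.log n - a))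
    with hPiA
  set W₁ : ℝ := ∫ t, w t with hW₁
  set W₂ : ℝ := ∫ t, w t ^ 2 with hW₂
  have hW₁0 : 0 ≤ W₁ := integral_nonneg hw0
  have hW₂0 : 0 ≤ W₂ := integral_nonneg fun t => sq_nonneg _
  have hΦa := weilThetaPhi_pos a
  have hκr : Continuous κr := continuous_leakKer hκd
  -- `f` is the complexified real leakage function
  have hfF : ∀ t, f t = ((F t : ℝ) : ℂ) := fun t => weilConv_leak_eq w χ t
  have hF0 : ∀ t, 0 ≤ F t := leakFun_nonneg hw0 hχ01
  have hf0 : f 0 = 0 := by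
    rw [hfF, hFdef]
    dsimp only
    rw [leakFun_zero hws hχ1, Complex.ofReal_zero]
  -- pointwise bounds on `F`
  have hF1 : ∀ x, F x ≤ weilThetaPhi (max a (|x| - a)) * W₁ := fun x =>
    leakNeg_leakFun_le_l1 ha.le hwi hw0 hws hχ1 hχ01 x
  have hF1' : ∀ x, F x ≤ weilThetaPhi a * W₁ := fun x =>
    (hF1 x).trans (mul_le_mul_of_nonneg_right
      (leakNeg_phi_le_of_le_abs ha.le ((le_max_left _ _).trans (le_abs_self _))) hW₁0)
  have hF2 : ∀ t, 0 ≤ t → F t ≤ weilThetaPhi a * (Real.sqrt t * Real.sqrt W₂) := fun t ht =>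
    leakNeg_leakFun_le_l2 ha.le hwi hw2 hw0 hws hχ1 hχ01 ht
  have hF2' : ∀ t, 0 ≤ t → F (-t) ≤ weilThetaPhi a * (Real.sqrt t * Real.sqrt W₂) := fun t ht =>
    leakNeg_leakFun_neg_le_l2 ha.le hwi hw2 hw0 hws hχ1 hχ01 ht
  -- weighted-`L¹` data of `w`
  have hwa : AEStronglyMeasurable wc volume := hwi.ofReal.aestronglyMeasurable
  have hww : ∀ b : ℝ, Integrable (fun t : ℝ => ‖wc t‖ * Real.exp (b * |t|)) := by
    intro b
    refine (hwi.norm.mul_const (Real.exp (|b| * a))).mono' (hwa.norm.mul (by fun_prop))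
      (ae_of_all _ fun t => ?_)
    rw [Real.norm_eq_abs, abs_of_nonneg (by positivity), hwc]
    dsimp only
    rw [Complex.norm_real]
    by_cases ht : t ∈ Icc (-a) a
    · refine mul_le_mul_of_nonneg_left (Real.exp_le_exp.2 ?_) (norm_nonneg _)
      have h1 : |t| ≤ a := abs_le.2 ⟨ht.1, ht.2⟩
      calc b * |t| ≤ |b| * |t| := mul_le_mul_of_nonneg_right (le_abs_self b) (abs_nonneg t)
        _ ≤ |b| * a := mul_le_mul_of_nonneg_left h1 (abs_nonneg b)
    · rw [hws t ht]; simp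
  -- the class data of `f`
  obtain ⟨hfcd, hfb, hmel⟩ := stub_strongClass_pairing wc κ 1 1 hwa (by norm_num) (hww 1) hκd
    (by norm_num) le_rfl hκb
  obtain ⟨Cf, hf0', hf1', hf2'⟩ := hExt_deriv_bounds_of_all hfb
  -- (1) the polar term is non-negative
  have hM0 : weilMellin f 0 = weilMellin wc 0 * conj (weilMellin κ 1) := by
    have h := hmel 0 (by simp) (by simp)
    simpa using h
  have hM1 : weilMellin f 1 = weilMellin wc 1 * conj (weilMellin κ 0) := by
    have h := hmel 1 (by simp) (by simp)
    simpa using h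
  have hw0M : weilMellin wc 0 = ((∫ t, w t * Real.exp (-(1 / 2) * t) : ℝ) : ℂ) :=
    leakSign_weilMellin_ofReal w (by push_cast; ring)
  have hw1M : weilMellin wc 1 = ((∫ t, w t * Real.exp (1 / 2 * t) : ℝ) : ℂ) :=
    leakSign_weilMellin_ofReal w (by push_cast; ring)
  have hκ0M : weilMellin κ 0 = ((∫ t, κr t * Real.exp (-(1 / 2) * t) : ℝ) : ℂ) :=
    leakSign_weilMellin_ofReal κr (by push_cast; ring)
  have hκ1M : weilMellin κ 1 = ((∫ t, κr t * Real.exp (1 / 2 * t) : ℝ) : ℂ) :=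
    leakSign_weilMellin_ofReal κr (by push_cast; ring)
  have hpolar : 0 ≤ (weilPolarTerm f).re := by
    rw [weilPolarTerm, hM0, hM1, hw0M, hw1M, hκ0M, hκ1M, Complex.conj_ofReal, Complex.conj_ofReal]
    simp only [Complex.add_re, Complex.mul_re, Complex.ofReal_re, Complex.ofReal_im, mul_zero,
      sub_zero]
    have hA₀ : 0 ≤ ∫ t, w t * Real.exp (-(1 / 2) * t) :=
      integral_nonneg fun t => mul_nonneg (hw0 t) (Real.exp_pos _).le
    have hA₁ : 0 ≤ ∫ t, w t * Real.exp (1 / 2 * t) :=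
      integral_nonneg fun t => mul_nonneg (hw0 t) (Real.exp_pos _).le
    have hK₀ : 0 ≤ ∫ t, κr t * Real.exp (-(1 / 2) * t) :=
      integral_nonneg fun t => mul_nonneg (leakKer_nonneg hχ01 t) (Real.exp_pos _).le
    have hK₁ : 0 ≤ ∫ t, κr t * Real.exp (1 / 2 * t) :=
      integral_nonneg fun t => mul_nonneg (leakKer_nonneg hχ01 t) (Real.exp_pos _).le
    positivity
  -- (2) the prime term is at most `Π_a ∫ w`
  have hprime : (weilPrimeTerm f).re ≤ PiA * W₁ := by
    have e : weilPrimeTerm f = ((∑' n : ℕ, ((Λ n : ℝ) / Real.sqrt n *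
        (F (Real.log n) + F (-Real.log n))) : ℝ) : ℂ) := by
      rw [weilPrimeTerm, Complex.ofReal_tsum]
      refine tsum_congr fun n => ?_
      rw [hfF, hfF]
      push_cast
      ring
    rw [e, Complex.ofReal_re]
    have hmaj := (leakNeg_summable_primeMajorant a).mul_right (2 * W₁)
    have hle : ∀ n : ℕ, (Λ n : ℝ) / Real.sqrt n * (F (Real.log n) + F (-Real.log n)) ≤
        (Λ n : ℝ) / Real.sqrt n * weilThetaPhi (max a (Real.log n - a)) * (2 * W₁) := by
      intro n
      have hlog : |Real.log (n : ℝ)| = Real.log n := abs_of_nonneg (Real.log_natCast_nonneg n)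
      have h1 : F (Real.log n) ≤ weilThetaPhi (max a (Real.log n - a)) * W₁ := by
        have := hF1 (Real.log n); rwa [hlog] at this
      have h2 : F (-Real.log n) ≤ weilThetaPhi (max a (Real.log n - a)) * W₁ := by
        have := hF1 (-Real.log n); rwa [abs_neg, hlog] at this
      rw [mul_assoc]
      exact mul_le_mul_of_nonneg_left (by linarith)
        (div_nonneg ArithmeticFunction.vonMangoldt_nonneg (Real.sqrt_nonneg _))
    have hnn : ∀ n : ℕ, 0 ≤ (Λ n : ℝ) / Real.sqrt n * (F (Real.log n) + F (-Real.log n)) :=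
      fun n => mul_nonneg (div_nonneg ArithmeticFunction.vonMangoldt_nonneg (Real.sqrt_nonneg _))
        (add_nonneg (hF0 _) (hF0 _))
    have hmin : Summable fun n : ℕ =>
        (Λ n : ℝ) / Real.sqrt n * (F (Real.log n) + F (-Real.log n)) :=
      Summable.of_nonneg_of_le hnn hle hmaj
    calc ∑' n : ℕ, (Λ n : ℝ) / Real.sqrt n * (F (Real.log n) + F (-Real.log n))
        ≤ ∑' n : ℕ, (Λ n : ℝ) / Real.sqrt n * weilThetaPhi (max a (Real.log n - a)) * (2 * W₁) :=
          hmin.tsum_le_tsum hle hmaj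
      _ = PiA * W₁ := by rw [tsum_mul_right, hPiA]; ring
  -- (3) the archimedean term is at least `-Φ(a)(4√W₂ + 8W₁)` (Bombieri's form, `f(0) = 0`)
  have harch : -(weilThetaPhi a * (4 * Real.sqrt W₂ + 8 * W₁)) ≤ (weilArchTerm f).re := by
    rw [← weilArchTermBombieri_eq_weilArchTerm_expClass hfcd (by norm_num : (1 : ℝ) / 2 < 1)
      hf0' hf1' hf2', weilArchTermBombieri, ← hf, hf0]
    have e : ∫ t in Ioi (0 : ℝ), ((Real.exp (t / 2) : ℂ) * (f t + f (-t)) - 2 * (0 : ℂ)) /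
        (2 * Real.sinh t : ℂ) =
        ((∫ t in Ioi (0 : ℝ), Real.exp (t / 2) * (F t + F (-t)) /
          (2 * Real.sinh t) : ℝ) : ℂ) := by
      rw [← integral_complex_ofReal]
      refine integral_congr_ae (ae_of_all _ fun t => ?_)
      dsimp only
      rw [hfF, hfF]
      push_cast
      ring
    rw [e]
    simp only [mul_zero, zero_add, Complex.neg_re, Complex.ofReal_re, neg_le_neg_iff]
    -- majorant `G = G₁ + G₂` on `(0, ∞)`
    set G₁ : ℝ → ℝ := fun t => (Ioc (0 : ℝ) 1).indicator
      (fun t => 2 * (weilThetaPhi a * Real.sqrt W₂) * t ^ (-(1 / 2 : ℝ))) t with hG₁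
    set G₂ : ℝ → ℝ := fun t => 4 * (weilThetaPhi a * W₁) * Real.exp (-(1 / 2) * t) with hG₂
    have hG₁i : IntegrableOn G₁ (Ioi 0) := by
      refine Integrable.integrableOn ?_
      rw [hG₁, integrable_indicator_iff measurableSet_Ioc]
      have h := (intervalIntegral.intervalIntegrable_rpow' (a := 0) (b := 1)
        (r := -(1 / 2 : ℝ)) (by norm_num)).1
      exact h.const_mul _
    have hG₂i : IntegrableOn G₂ (Ioi 0) :=
      (integrableOn_exp_mul_Ioi (by norm_num : -(1 / 2 : ℝ) < 0) 0).const_mul _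
    have hG₁int : ∫ t in Ioi (0 : ℝ), G₁ t = 4 * (weilThetaPhi a * Real.sqrt W₂) := by
      rw [hG₁, setIntegral_indicator measurableSet_Ioc,
        inter_eq_right.2 (Ioc_subset_Ioi_self : Ioc (0 : ℝ) 1 ⊆ Ioi 0), integral_const_mul,
        leakNeg_integral_rpow_neg_half]
      ring
    have hG₂int : ∫ t in Ioi (0 : ℝ), G₂ t = 8 * (weilThetaPhi a * W₁) := by
      rw [hG₂, integral_const_mul, leakNeg_integral_exp_neg_half]; ring
    have hle : ∀ t ∈ Ioi (0 : ℝ),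
        Real.exp (t / 2) * (F t + F (-t)) / (2 * Real.sinh t) ≤ G₁ t + G₂ t := by
      intro t ht
      have ht0 : 0 < t := ht
      have hsinh0 : 0 < Real.sinh t := Real.sinh_pos_iff.2 ht0
      have hG₁0 : 0 ≤ G₁ t := by
        simp only [hG₁]
        by_cases h : t ∈ Ioc (0 : ℝ) 1
        · rw [indicator_of_mem h]
          exact mul_nonneg (by positivity) (Real.rpow_nonneg ht0.le _)
        · rw [indicator_of_notMem h]
      have hG₂0 : 0 ≤ G₂ t := by simp only [hG₂]; positivity
      by_cases ht1 : t ≤ 1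
      · -- small `t`: `L²` collar bound
        have hsum : F t + F (-t) ≤ 2 * (weilThetaPhi a * Real.sqrt W₂ * Real.sqrt t) := by
          have h1 := hF2 t ht0.le
          have h2 := hF2' t ht0.le
          nlinarith
        have hmem : t ∈ Ioc (0 : ℝ) 1 := ⟨ht0, ht1⟩
        calc Real.exp (t / 2) * (F t + F (-t)) / (2 * Real.sinh t)
            ≤ Real.exp (t / 2) * (2 * (weilThetaPhi a * Real.sqrt W₂ * Real.sqrt t)) /
                (2 * Real.sinh t) := by
              gcongr
          _ ≤ 2 * (weilThetaPhi a * Real.sqrt W₂) * t ^ (-(1 / 2 : ℝ)) :=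
              leakNeg_arch_majorant_small ht0 ht1 (by positivity)
          _ = G₁ t := by simp only [hG₁]; rw [indicator_of_mem hmem]
          _ ≤ G₁ t + G₂ t := le_add_of_nonneg_right hG₂0
      · -- large `t`: `L¹` bound
        have ht1' : 1 < t := not_le.1 ht1
        have hsum : F t + F (-t) ≤ 2 * (weilThetaPhi a * W₁) := by
          have h1 := hF1' t
          have h2 := hF1' (-t)
          linarith
        calc Real.exp (t / 2) * (F t + F (-t)) / (2 * Real.sinh t)
            ≤ Real.exp (t / 2) * (2 * (weilThetaPhi a * W₁)) / (2 * Real.sinh t) := by gcongr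
          _ ≤ 4 * (weilThetaPhi a * W₁) * Real.exp (-(1 / 2) * t) :=
              leakNeg_arch_majorant_large ht1' (by positivity)
          _ = G₂ t := by simp only [hG₂]
          _ ≤ G₁ t + G₂ t := le_add_of_nonneg_left hG₁0
    have hnn : 0 ≤ᵐ[volume.restrict (Ioi (0 : ℝ))]
        fun t => Real.exp (t / 2) * (F t + F (-t)) / (2 * Real.sinh t) := by
      filter_upwards [ae_restrict_mem measurableSet_Ioi] with t ht
      exact div_nonneg (mul_nonneg (Real.exp_pos _).le (add_nonneg (hF0 _) (hF0 _)))
        (mul_nonneg zero_le_two (Real.sinh_pos_iff.2 (show 0 < t from ht)).le)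
    calc ∫ t in Ioi (0 : ℝ), Real.exp (t / 2) * (F t + F (-t)) / (2 * Real.sinh t)
        ≤ ∫ t in Ioi (0 : ℝ), (G₁ t + G₂ t) :=
          integral_mono_of_nonneg hnn (hG₁i.add hG₂i)
            (by filter_upwards [ae_restrict_mem measurableSet_Ioi] with t ht; exact hle t ht)
      _ = (∫ t in Ioi (0 : ℝ), G₁ t) + ∫ t in Ioi (0 : ℝ), G₂ t := integral_add hG₁i hG₂i
      _ = weilThetaPhi a * (4 * Real.sqrt W₂ + 8 * W₁) := by rw [hG₁int, hG₂int]; ring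
  -- (4) assemble
  have hW : (weilFunctional f).re = (weilPolarTerm f).re - (weilPrimeTerm f).re +
      (weilArchTerm f).re := by
    rw [weilFunctional, Complex.add_re, Complex.sub_re]
  rw [hW]
  nlinarith [leakNeg_primeMajorant_nonneg a]

end Summit.RiemannHypothesis.RiemannHypothesis.Theorems.GroundBartaFloor

end
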